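import Summits.ResolutionOfSingularities.ResolutionOfSingularities.Theorems.EquisingularLiftEquisingularLiftNatEquinodalSectionOfVec
import Summits.ResolutionOfSingularities.ResolutionOfSingularities.Theorems.EquisingularLiftEquisingularLiftNatEquinodalHyperplaneAlg
import Summits.ResolutionOfSingularities.ResolutionOfSingularities.Theorems.FrobeniusClosingPatchingRelPerfectDepthGradedCharts
import Literature.AlgebraicGeometry.Resolution.AlterationsSectionDivisor
import HarnessLib

/-!
# [OURS · L1 W4.5(b) · EL♮(3) · door ν4, brick N-0, core S8 — shared dictionary] THE STALK OF `ker [a]` AT THE `O`-POINT `[a]`: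
# ★ `SectionOfVec.stalkIdeal_ker_sectionOfVec_eq` — at `x = [a](p)` the kernel ideal sheaf of the explicit section `[a] : Spec R ⟶ ℙⁿ_R`
# (✓ `SectionOfVec`, `a d = 1`) has stalk = the stalk of `(x_j − a_j x_d)_j~`, i.e. it is generated by the germs `(x_j − a_j x_d)/x_d`

res-L1-w45b-stub-4 g13 (desk WORD g25-5 default: core S8 `SplitNodeAt`; this file is the dictionary it needs, cut separately because the W5 / S7
pens need the same local description at the section points).  DEF-FREE; no `sorry`; standard axioms.  `--supports stmt-ResolutionOfSingularities-20148
--as helper`, counted 0.  EL♮(3) is NOT proved; resolution of singularities in positive characteristic is NOT proved.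

WHAT.  For `a : Fin (n+1) → R`, `a d = 1`, `s := [a] = Spec (ev_a) ≫ awayι (x_d)` (✓ `SectionOfVec`):
* `mem_span_mk₁_of_eval_eq_zero` (CHART KERNEL, pure algebra): an element of `(R[x]_{x_d})₀` killed by `ev_a` lies in the ideal spanned by the
  `(x_j − a_j x_d)/x_d` (homogeneous Taylor: `F − F(a)·x_d^m ∈ (x_j − a_j x_d)_j`, ✓ `HyperplaneAlg.sub_algHom_mem_span` + ✓ `awayIdeal_span_eq`);
* `stalkMap_germ_awayToSection` (STALK DICTIONARY): `s♯_p (germ_x (F/x_d^m)) = toStalk_p (F(a))`;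
* ★ `stalkIdeal_ker_sectionOfVec_eq` (`R` local, `p = 𝔪`): `(ker s)_x = ((x_j − a_j x_d)_j~)_x` (`≥` is ✓ `projIdealSheaf_le_ker_sectionOfVec`).
-/

set_option linter.dupNamespace false -- mandated namespace `Summit.<Summit>.<Problem>` of this single-conjunct summit

noncomputable section

open CategoryTheory AlgebraicGeometry TopologicalSpace
open MvPolynomial HomogeneousLocalization
open Literature.AlgebraicGeometry.Resolution
open AlgebraicGeometry.Scheme.IdealSheafData

namespace Summit.ResolutionOfSingularities.ResolutionOfSingularities.Cruxes.EquisingularLiftNat.Sections.Equinodal.SectionOfVec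

universe u

variable {R : Type} [CommRing R] {n : ℕ}

/-- the linear forms `x_j − a_j · x_d` are homogeneous of degree one. [folklore] -/
theorem X_sub_C_mul_X_mem_one (a : Fin (n + 1) → R) (d j : Fin (n + 1)) :
    (X j - C (a j) * X d : MvPolynomial (Fin (n + 1)) R) ∈ homogeneousSubmodule (Fin (n + 1)) R 1 :=
  (mem_homogeneousSubmodule _ _).mpr ((isHomogeneous_X R j).sub ((isHomogeneous_X R d).C_mul (a j)))

/-- scaling the arguments of a form of degree `m` by `c` scales its value by `c^m` (algebra-valued evaluation). [folklore] -/
theorem aeval_const_mul_of_isHomogeneous {S : Type*} [CommRing S] [Algebra R S] {σ : Type*} {F : MvPolynomial σ R} {m : ℕ}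
    (hF : F.IsHomogeneous m) (c : S) (y : σ → S) :
    aeval (fun i => c * y i) F = c ^ m * aeval y F := by
  classical
  conv_lhs => rw [← F.support_sum_monomial_coeff]
  conv_rhs => rw [← F.support_sum_monomial_coeff]
  rw [map_sum, map_sum, Finset.mul_sum]
  refine Finset.sum_congr rfl fun s hs => ?_
  rw [aeval_monomial, aeval_monomial, hF.degree_eq_sum_deg_support hs]
  simp only [Finsupp.prod, mul_pow, Finset.prod_mul_distrib, Finset.prod_pow_eq_pow_sum]
  ring

/-- constant substitution: `F(C a₀, …, C aₙ) = C (F(a))`. [folklore] -/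
theorem aeval_C_comp (a : Fin (n + 1) → R) (F : MvPolynomial (Fin (n + 1)) R) :
    aeval (fun j => (C (a j) : MvPolynomial (Fin (n + 1)) R)) F = C (MvPolynomial.eval a F) := by
  induction F using MvPolynomial.induction_on with
  | C r => simp
  | add p q hp hq => simp only [map_add, hp, hq]
  | mul_X p j hp => simp only [map_mul, hp, aeval_X, eval_X]

/-- substituting `x_j ↦ a_j · x_d` into a form of degree `m` gives `x_d^m · F(a)`. [folklore] -/
theorem aeval_C_mul_X_of_mem (a : Fin (n + 1) → R) (d : Fin (n + 1)) {m : ℕ} (F : MvPolynomial (Fin (n + 1)) R)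
    (hF : F ∈ homogeneousSubmodule (Fin (n + 1)) R m) :
    aeval (fun j => C (a j) * X d) F = X d ^ m * C (MvPolynomial.eval a F) := by
  have hF' : F.IsHomogeneous m := (mem_homogeneousSubmodule _ _).mp hF
  have h3 : (fun j => C (a j) * X d : Fin (n + 1) → MvPolynomial (Fin (n + 1)) R) = fun j => X d * C (a j) :=
    funext fun j => mul_comm _ _
  rw [h3, aeval_const_mul_of_isHomogeneous hF' (X d) (fun j => C (a j)), aeval_C_comp]

/-- **CHART KERNEL.**  In `(R[x]_{x_d})₀`: an element killed by the evaluation `ev_a` (`a d = 1`) lies in the ideal spanned by the dehomogenised linear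
forms `(x_j − a_j x_d)/x_d` — homogeneous Taylor `F − F(a)·x_d^m ∈ (x_j − a_j x_d)_j` (✓ `HyperplaneAlg.sub_algHom_mem_span`) and ✓ `awayIdeal_span_eq`.
[folklore] -/
theorem mem_span_mk₁_of_eval_eq_zero (a : Fin (n + 1) → R) (d : Fin (n + 1)) (ha : a d = 1)
    (c : HomogeneousLocalization.Away (homogeneousSubmodule (Fin (n + 1)) R) (X d : MvPolynomial (Fin (n + 1)) R))
    (hc : letI := MvPolynomial.gradedAlgebra (σ := Fin (n + 1)) (R := R)
      ((Localization.awayLift (MvPolynomial.eval a) (X d : MvPolynomial (Fin (n + 1)) R) (isUnit_eval_X a d ha)).comp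
        (algebraMap (HomogeneousLocalization.Away (homogeneousSubmodule (Fin (n + 1)) R) (X d : MvPolynomial (Fin (n + 1)) R))
          (Localization.Away (X d : MvPolynomial (Fin (n + 1)) R)))) c = 0) :
    letI := MvPolynomial.gradedAlgebra (σ := Fin (n + 1)) (R := R)
    c ∈ Ideal.span (Set.range fun j : Fin (n + 1) =>
      mk₁ (homogeneousSubmodule (Fin (n + 1)) R) (isHomogeneous_X R d) 1 (X j - C (a j) * X d) (X_sub_C_mul_X_mem_one a d j)) := by
  letI := MvPolynomial.gradedAlgebra (σ := Fin (n + 1)) (R := R)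
  obtain ⟨m, F, hF, rfl⟩ := HomogeneousLocalization.Away.mk_surjective (homogeneousSubmodule (Fin (n + 1)) R) (isHomogeneous_X R d) c
  have hF1 : F ∈ homogeneousSubmodule (Fin (n + 1)) R m := by simpa using hF
  -- `ev_a (F / x_d^m) = F(a) = 0`
  have hmk : HomogeneousLocalization.Away.mk (homogeneousSubmodule (Fin (n + 1)) R) (isHomogeneous_X R d) m F hF =
      mk₁ (homogeneousSubmodule (Fin (n + 1)) R) (isHomogeneous_X R d) m F hF1 := rfl
  rw [hmk, eval_mk₁ a d ha] at hc
  -- homogeneous Taylor: `F − F(a)·x_d^m ∈ (x_j − a_j x_d)_j`, and `F(a) = 0`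
  have hmem : F ∈ Ideal.span (Set.range fun j : Fin (n + 1) => (X j - C (a j) * X d : MvPolynomial (Fin (n + 1)) R)) := by
    have h := HyperplaneAlg.sub_algHom_mem_span (aeval fun j : Fin (n + 1) => (C (a j) * X d : MvPolynomial (Fin (n + 1)) R)) F
    rw [aeval_C_mul_X_of_mem a d F hF1, hc, C_0, mul_zero, sub_zero] at h
    simpa only [aeval_X] using h
  -- dehomogenise
  rw [hmk, ← awayIdeal_span_eq (homogeneousSubmodule (Fin (n + 1)) R) (isHomogeneous_X R d) _ (fun _ => 1)
    (fun j => X_sub_C_mul_X_mem_one a d j)]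
  exact mk_mem_awayIdeal (homogeneousSubmodule (Fin (n + 1)) R) (isHomogeneous_X R d) (by simpa using hF1) hmem

/-- the `O`-point `[a]` lands in the chart `D₊(x_d)`. [folklore] -/
theorem sectionOfVec_mem_basicOpen (a : Fin (n + 1) → R) (d : Fin (n + 1)) (ha : a d = 1) (p : Spec (.of R)) :
    letI := MvPolynomial.gradedAlgebra (σ := Fin (n + 1)) (R := R)
    (Spec.map (CommRingCat.ofHom ((Localization.awayLift (MvPolynomial.eval a) (X d : MvPolynomial (Fin (n + 1)) R) (isUnit_eval_X a d ha)).comp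
        (algebraMap (HomogeneousLocalization.Away (homogeneousSubmodule (Fin (n + 1)) R) (X d : MvPolynomial (Fin (n + 1)) R))
          (Localization.Away (X d : MvPolynomial (Fin (n + 1)) R))))) ≫
      Proj.awayι (homogeneousSubmodule (Fin (n + 1)) R) (X d) (isHomogeneous_X R d) one_pos) p ∈
      Proj.basicOpen (homogeneousSubmodule (Fin (n + 1)) R) (X d : MvPolynomial (Fin (n + 1)) R) := by
  letI := MvPolynomial.gradedAlgebra (σ := Fin (n + 1)) (R := R)
  rw [Scheme.Hom.comp_apply, ← Proj.opensRange_awayι (homogeneousSubmodule (Fin (n + 1)) R) (X d) (isHomogeneous_X R d) one_pos]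
  exact ⟨_, rfl⟩

/-- **STALK DICTIONARY.**  The stalk map of the `O`-point `[a]` at `p ∈ Spec R` sends the germ of a dehomogenised form `F / x_d^m` (a section over
`D₊(x_d)`) to the germ of the scalar `F(a)`: `[a]♯_p (germ (F/x_d^m)) = toStalk_p (F(a))`. [folklore; ✓ `appLE_awayι_awayToSection` + Mathlib
`ΓSpecIso_inv_naturality`] -/
theorem stalkMap_germ_awayToSection (a : Fin (n + 1) → R) (d : Fin (n + 1)) (ha : a d = 1) (p : Spec (.of R))
    {m : ℕ} (F : MvPolynomial (Fin (n + 1)) R) (hF : F ∈ homogeneousSubmodule (Fin (n + 1)) R m) :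
    letI := MvPolynomial.gradedAlgebra (σ := Fin (n + 1)) (R := R)
    ((Spec.map (CommRingCat.ofHom ((Localization.awayLift (MvPolynomial.eval a) (X d : MvPolynomial (Fin (n + 1)) R) (isUnit_eval_X a d ha)).comp
        (algebraMap (HomogeneousLocalization.Away (homogeneousSubmodule (Fin (n + 1)) R) (X d : MvPolynomial (Fin (n + 1)) R))
          (Localization.Away (X d : MvPolynomial (Fin (n + 1)) R))))) ≫
      Proj.awayι (homogeneousSubmodule (Fin (n + 1)) R) (X d) (isHomogeneous_X R d) one_pos).stalkMap p)
      ((Proj (homogeneousSubmodule (Fin (n + 1)) R)).presheaf.germ (Proj.basicOpen (homogeneousSubmodule (Fin (n + 1)) R) (X d)) _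
        (sectionOfVec_mem_basicOpen a d ha p)
        (Proj.awayToSection (homogeneousSubmodule (Fin (n + 1)) R) (X d)
          (mk₁ (homogeneousSubmodule (Fin (n + 1)) R) (isHomogeneous_X R d) m F hF))) =
      StructureSheaf.toStalk R p (MvPolynomial.eval a F) := by
  letI := MvPolynomial.gradedAlgebra (σ := Fin (n + 1)) (R := R)
  set φ : HomogeneousLocalization.Away (homogeneousSubmodule (Fin (n + 1)) R) (X d : MvPolynomial (Fin (n + 1)) R) →+* R :=
    (Localization.awayLift (MvPolynomial.eval a) (X d : MvPolynomial (Fin (n + 1)) R) (isUnit_eval_X a d ha)).comp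
      (algebraMap (HomogeneousLocalization.Away (homogeneousSubmodule (Fin (n + 1)) R) (X d : MvPolynomial (Fin (n + 1)) R))
        (Localization.Away (X d : MvPolynomial (Fin (n + 1)) R))) with hφ
  set s := Spec.map (CommRingCat.ofHom φ) ≫ Proj.awayι (homogeneousSubmodule (Fin (n + 1)) R) (X d) (isHomogeneous_X R d) one_pos with hs
  set U := Proj.basicOpen (homogeneousSubmodule (Fin (n + 1)) R) (X d : MvPolynomial (Fin (n + 1)) R) with hU
  set c := mk₁ (homogeneousSubmodule (Fin (n + 1)) R) (isHomogeneous_X R d) m F hF with hc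
  have hx : s p ∈ U := sectionOfVec_mem_basicOpen a d ha p
  show (s.stalkMap p) ((Proj (homogeneousSubmodule (Fin (n + 1)) R)).presheaf.germ U (s p) hx
    (Proj.awayToSection (homogeneousSubmodule (Fin (n + 1)) R) (X d) c)) = StructureSheaf.toStalk R p (MvPolynomial.eval a F)
  -- the germ through the stalk map is the germ of `s^* (awayToSection c)` over `s⁻¹ U`
  rw [Scheme.Hom.germ_stalkMap_apply s U p hx]
  -- split `s^*` over `D₊(x_d)` as `awayι^*` to `⊤` followed by `(Spec φ)^*` from `⊤` to `s⁻¹ U`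
  have e₁ : (⊤ : (Spec (.of (HomogeneousLocalization.Away (homogeneousSubmodule (Fin (n + 1)) R) (X d : MvPolynomial (Fin (n + 1)) R)))).Opens) ≤
      Proj.awayι (homogeneousSubmodule (Fin (n + 1)) R) (X d) (isHomogeneous_X R d) one_pos ⁻¹ᵁ U := by
    intro y _
    show (Proj.awayι (homogeneousSubmodule (Fin (n + 1)) R) (X d) (isHomogeneous_X R d) one_pos) y ∈ U
    rw [hU, ← Proj.opensRange_awayι (homogeneousSubmodule (Fin (n + 1)) R) (X d) (isHomogeneous_X R d) one_pos]
    exact ⟨y, rfl⟩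
  have e₂ : s ⁻¹ᵁ U ≤ Spec.map (CommRingCat.ofHom φ) ⁻¹ᵁ
      (⊤ : (Spec (.of (HomogeneousLocalization.Away (homogeneousSubmodule (Fin (n + 1)) R) (X d : MvPolynomial (Fin (n + 1)) R)))).Opens) :=
    le_top
  have happ : s.app U = (Proj.awayι (homogeneousSubmodule (Fin (n + 1)) R) (X d) (isHomogeneous_X R d) one_pos).appLE U ⊤ e₁ ≫
      (Spec.map (CommRingCat.ofHom φ)).appLE ⊤ (s ⁻¹ᵁ U) e₂ := by
    rw [Scheme.Hom.appLE_comp_appLE, Scheme.Hom.app_eq_appLE]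
  rw [happ, CommRingCat.comp_apply,
    Summit.ResolutionOfSingularities.ResolutionOfSingularities.Theorems.DepthOne.appLE_awayι_awayToSection
      (homogeneousSubmodule (Fin (n + 1)) R) (X d) (isHomogeneous_X R d) one_pos e₁ c]
  -- `(Spec φ)^*` from `⊤`: restriction of `app ⊤`, and `(Spec φ)^*_⊤ ∘ ΓSpecIso⁻¹ = ΓSpecIso⁻¹ ∘ φ`
  rw [Scheme.Hom.appLE, CommRingCat.comp_apply, TopCat.Presheaf.germ_res_apply]
  have hnat : (Spec.map (CommRingCat.ofHom φ)).app ⊤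
      ((Scheme.ΓSpecIso (.of (HomogeneousLocalization.Away (homogeneousSubmodule (Fin (n + 1)) R) (X d : MvPolynomial (Fin (n + 1)) R)))).inv c) =
      (Scheme.ΓSpecIso (.of R)).inv (φ c) := by
    have h := congrArg (fun g : (CommRingCat.of (HomogeneousLocalization.Away (homogeneousSubmodule (Fin (n + 1)) R) (X d : MvPolynomial (Fin (n + 1)) R))) ⟶
        Γ(Spec (.of R), ⊤) => g c) (Scheme.ΓSpecIso_inv_naturality (CommRingCat.ofHom φ))
    exact h.symm
  rw [hnat]
  -- the germ of `ΓSpecIso⁻¹ r` at `p` is `toStalk_p r`; and `φ c = F(a)`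
  change ((Scheme.ΓSpecIso (.of R)).inv ≫ (Spec (.of R)).presheaf.germ ⊤ p trivial) (φ c) = _
  have hts : (Scheme.ΓSpecIso (.of R)).inv ≫ (Spec (.of R)).presheaf.germ ⊤ p trivial = StructureSheaf.toStalk R p :=
    StructureSheaf.algebraMap_germ (R := R) ⊤ p trivial
  rw [hts, hc, hφ, eval_mk₁ a d ha m F hF]
  rfl

/-- ★ **THE STALK OF `ker [a]` AT THE `R`-POINT** (`R` local, `p = 𝔪_R`, `x = [a](𝔪)`): if `[a]` is a closed immersion (e.g. `ℙⁿ_R → Spec R`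
separated, ✓ `IsUnionOfSections.isClosedImmersion_of_comp_eq_id`), then `(ker [a])_x ≤ ((x_j − a_j x_d)_j~)_x` — with ✓ `projIdealSheaf_le_ker_sectionOfVec`
this is an EQUALITY (`stalkIdeal_ker_sectionOfVec_eq`).  Proof: `(ker [a])_x = ker [a]♯_x` (✓ `stalkIdeal_ker_eq_ker_stalkMap`); a germ `F/x_d^m`
in the kernel has `toStalk (F(a)) = 0` (`stalkMap_germ_awayToSection`), so `F(a) = 0` (`R → R_𝔪` is injective for `R` local) and the CHART KERNEL
lemma applies. [folklore] -/
theorem stalkIdeal_ker_sectionOfVec_le [IsLocalRing R] (a : Fin (n + 1) → R) (d : Fin (n + 1)) (ha : a d = 1)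
    (hci : letI := MvPolynomial.gradedAlgebra (σ := Fin (n + 1)) (R := R)
      IsClosedImmersion (Spec.map (CommRingCat.ofHom ((Localization.awayLift (MvPolynomial.eval a) (X d : MvPolynomial (Fin (n + 1)) R)
        (isUnit_eval_X a d ha)).comp
        (algebraMap (HomogeneousLocalization.Away (homogeneousSubmodule (Fin (n + 1)) R) (X d : MvPolynomial (Fin (n + 1)) R))
          (Localization.Away (X d : MvPolynomial (Fin (n + 1)) R))))) ≫
      Proj.awayι (homogeneousSubmodule (Fin (n + 1)) R) (X d) (isHomogeneous_X R d) one_pos)) :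
    letI := MvPolynomial.gradedAlgebra (σ := Fin (n + 1)) (R := R)
    stalkIdeal (Spec.map (CommRingCat.ofHom ((Localization.awayLift (MvPolynomial.eval a) (X d : MvPolynomial (Fin (n + 1)) R) (isUnit_eval_X a d ha)).comp
        (algebraMap (HomogeneousLocalization.Away (homogeneousSubmodule (Fin (n + 1)) R) (X d : MvPolynomial (Fin (n + 1)) R))
          (Localization.Away (X d : MvPolynomial (Fin (n + 1)) R))))) ≫
      Proj.awayι (homogeneousSubmodule (Fin (n + 1)) R) (X d) (isHomogeneous_X R d) one_pos).ker
      ((Spec.map (CommRingCat.ofHom ((Localization.awayLift (MvPolynomial.eval a) (X d : MvPolynomial (Fin (n + 1)) R) (isUnit_eval_X a d ha)).comp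
        (algebraMap (HomogeneousLocalization.Away (homogeneousSubmodule (Fin (n + 1)) R) (X d : MvPolynomial (Fin (n + 1)) R))
          (Localization.Away (X d : MvPolynomial (Fin (n + 1)) R))))) ≫
      Proj.awayι (homogeneousSubmodule (Fin (n + 1)) R) (X d) (isHomogeneous_X R d) one_pos) (IsLocalRing.closedPoint R)) ≤
    stalkIdeal (projIdealSheaf (homogeneousSubmodule (Fin (n + 1)) R)
        ⟨Ideal.span (Set.range fun j : Fin (n + 1) => (X j - C (a j) * X d : MvPolynomial (Fin (n + 1)) R)),
          isHomogeneous_span_of_forall_mem _ _ (fun _ => 1) (X_sub_C_mul_X_mem_one a d)⟩)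
      ((Spec.map (CommRingCat.ofHom ((Localization.awayLift (MvPolynomial.eval a) (X d : MvPolynomial (Fin (n + 1)) R) (isUnit_eval_X a d ha)).comp
        (algebraMap (HomogeneousLocalization.Away (homogeneousSubmodule (Fin (n + 1)) R) (X d : MvPolynomial (Fin (n + 1)) R))
          (Localization.Away (X d : MvPolynomial (Fin (n + 1)) R))))) ≫
      Proj.awayι (homogeneousSubmodule (Fin (n + 1)) R) (X d) (isHomogeneous_X R d) one_pos) (IsLocalRing.closedPoint R)) := by
  letI := MvPolynomial.gradedAlgebra (σ := Fin (n + 1)) (R := R)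
  set φ : HomogeneousLocalization.Away (homogeneousSubmodule (Fin (n + 1)) R) (X d : MvPolynomial (Fin (n + 1)) R) →+* R :=
    (Localization.awayLift (MvPolynomial.eval a) (X d : MvPolynomial (Fin (n + 1)) R) (isUnit_eval_X a d ha)).comp
      (algebraMap (HomogeneousLocalization.Away (homogeneousSubmodule (Fin (n + 1)) R) (X d : MvPolynomial (Fin (n + 1)) R))
        (Localization.Away (X d : MvPolynomial (Fin (n + 1)) R))) with hφ
  set s := Spec.map (CommRingCat.ofHom φ) ≫ Proj.awayι (homogeneousSubmodule (Fin (n + 1)) R) (X d) (isHomogeneous_X R d) one_pos with hs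
  set U := Proj.basicOpen (homogeneousSubmodule (Fin (n + 1)) R) (X d : MvPolynomial (Fin (n + 1)) R) with hU
  haveI : IsClosedImmersion s := hci
  set p := IsLocalRing.closedPoint R with hp
  have hx : s p ∈ U := sectionOfVec_mem_basicOpen a d ha p
  have hUaff : IsAffineOpen U := Proj.isAffineOpen_basicOpen _ (X d) (isHomogeneous_X R d) one_pos
  -- both stalks through the chart `D₊(x_d)`
  rw [stalkIdeal_ker_eq_ker_stalkMap s p, stalkIdeal_eq_map_germ _ ⟨U, hUaff⟩ hx,
    projIdealSheaf_ideal_basicOpen_span (homogeneousSubmodule (Fin (n + 1)) R) _ (fun _ => 1) (X_sub_C_mul_X_mem_one a d) _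
      (isHomogeneous_X R d)]
  -- the stalk is the localisation of `Γ(D₊(x_d))` at `x`
  letI alg := TopCat.Presheaf.algebra_section_stalk (Proj (homogeneousSubmodule (Fin (n + 1)) R)).presheaf (⟨s p, hx⟩ : U)
  haveI hloc := hUaff.isLocalization_stalk ⟨s p, hx⟩
  intro b hb
  rw [RingHom.mem_ker] at hb
  obtain ⟨⟨g, t⟩, rfl⟩ := IsLocalization.mk'_surjective (hUaff.primeIdealOf ⟨s p, hx⟩).asIdeal.primeCompl b
  rw [IsLocalization.mk'_mem_iff]
  -- `g = awayToSection c`, `c = F / x_d^m`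
  obtain ⟨c, rfl⟩ : ∃ c, (Proj.awayToSection (homogeneousSubmodule (Fin (n + 1)) R) (X d)) c = g :=
    ⟨(Proj.basicOpenIsoAway (homogeneousSubmodule (Fin (n + 1)) R) (X d) (isHomogeneous_X R d) one_pos).inv g,
      by rw [← Proj.basicOpenIsoAway_hom _ (X d) (isHomogeneous_X R d) one_pos, Iso.inv_hom_id_apply]⟩
  obtain ⟨m, F, hF, rfl⟩ := HomogeneousLocalization.Away.mk_surjective (homogeneousSubmodule (Fin (n + 1)) R) (isHomogeneous_X R d) c
  have hF1 : F ∈ homogeneousSubmodule (Fin (n + 1)) R m := by simpa using hF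
  have hmk : HomogeneousLocalization.Away.mk (homogeneousSubmodule (Fin (n + 1)) R) (isHomogeneous_X R d) m F hF =
      mk₁ (homogeneousSubmodule (Fin (n + 1)) R) (isHomogeneous_X R d) m F hF1 := rfl
  -- the germ of `g` is in the kernel of `s♯`, hence `F(a) = 0`
  have hgerm : (s.stalkMap p) ((Proj (homogeneousSubmodule (Fin (n + 1)) R)).presheaf.germ U (s p) hx
      ((Proj.awayToSection (homogeneousSubmodule (Fin (n + 1)) R) (X d)) (mk₁ (homogeneousSubmodule (Fin (n + 1)) R) (isHomogeneous_X R d) m F hF1))) = 0 := by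
    have hspec := IsLocalization.mk'_spec (M := (hUaff.primeIdealOf ⟨s p, hx⟩).asIdeal.primeCompl)
      ((Proj (homogeneousSubmodule (Fin (n + 1)) R)).presheaf.stalk (s p))
      ((Proj.awayToSection (homogeneousSubmodule (Fin (n + 1)) R) (X d)) (mk₁ (homogeneousSubmodule (Fin (n + 1)) R) (isHomogeneous_X R d) m F hF1)) t
    rw [← hmk] at hspec ⊢
    have h2 := congrArg (s.stalkMap p) hspec
    rw [map_mul, hb, zero_mul] at h2
    exact h2.symm
  rw [stalkMap_germ_awayToSection a d ha p F hF1] at hgerm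
  have hFa : MvPolynomial.eval a F = 0 := by
    haveI := StructureSheaf.IsLocalization.to_stalk R p
    have hinj : Function.Injective (StructureSheaf.toStalk R p) := by
      refine IsLocalization.injective (M := p.asIdeal.primeCompl) ((Spec (.of R)).presheaf.stalk p) ?_
      intro r hr
      have hr' : r ∉ IsLocalRing.maximalIdeal R := hr
      exact IsUnit.mem_nonZeroDivisors
        (not_not.mp fun h => hr' ((IsLocalRing.mem_maximalIdeal r).mpr (mem_nonunits_iff.mpr h)))
    exact hinj (hgerm.trans (map_zero _).symm)
  -- CHART KERNEL + back through `awayToSection` and `germ`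
  have hmem := mem_span_mk₁_of_eval_eq_zero a d ha (mk₁ (homogeneousSubmodule (Fin (n + 1)) R) (isHomogeneous_X R d) m F hF1)
    (by rw [eval_mk₁ a d ha]; exact hFa)
  have hsec : (Proj.awayToSection (homogeneousSubmodule (Fin (n + 1)) R) (X d))
      (mk₁ (homogeneousSubmodule (Fin (n + 1)) R) (isHomogeneous_X R d) m F hF1) ∈
      Ideal.span (Set.range fun j : Fin (n + 1) => (Proj.awayToSection (homogeneousSubmodule (Fin (n + 1)) R) (X d)).hom
        (mk₁ (homogeneousSubmodule (Fin (n + 1)) R) (isHomogeneous_X R d) ((fun _ => 1) j) (X j - C (a j) * X d) (X_sub_C_mul_X_mem_one a d j))) := by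
    have h := Ideal.mem_map_of_mem (Proj.awayToSection (homogeneousSubmodule (Fin (n + 1)) R) (X d)).hom hmem
    rwa [Ideal.map_span, ← Set.range_comp] at h
  rw [hmk]
  exact Ideal.mem_map_of_mem _ hsec

/-- the linear forms `x_j − a_j x_d` vanish at `a` (`a d = 1`). [folklore] -/
theorem eval_X_sub_C_mul_X (a : Fin (n + 1) → R) (d : Fin (n + 1)) (ha : a d = 1) (j : Fin (n + 1)) :
    MvPolynomial.eval a (X j - C (a j) * X d : MvPolynomial (Fin (n + 1)) R) = 0 := by
  simp [ha]

/-- ★★ **THE STALK OF `ker [a]` AT THE `R`-POINT IS THE STALK OF `(x_j − a_j x_d)_j~`** (`R` local, `[a]` a closed immersion): equality of the two stalk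
ideals at `x = [a](𝔪)` — `≤` is `stalkIdeal_ker_sectionOfVec_le`, `≥` is ✓ `projIdealSheaf_le_ker_sectionOfVec` (the forms vanish at `a`).  With
✓ `stalkIdeal_projIdealSheaf_span` the right side is the ideal spanned by the germs `(x_j − a_j x_d)/x_d`. [folklore] -/
theorem stalkIdeal_ker_sectionOfVec_eq [IsLocalRing R] (a : Fin (n + 1) → R) (d : Fin (n + 1)) (ha : a d = 1)
    (hci : letI := MvPolynomial.gradedAlgebra (σ := Fin (n + 1)) (R := R)
      IsClosedImmersion (Spec.map (CommRingCat.ofHom ((Localization.awayLift (MvPolynomial.eval a) (X d : MvPolynomial (Fin (n + 1)) R) (isUnit_eval_X a d ha)).comp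
        (algebraMap (HomogeneousLocalization.Away (homogeneousSubmodule (Fin (n + 1)) R) (X d : MvPolynomial (Fin (n + 1)) R))
          (Localization.Away (X d : MvPolynomial (Fin (n + 1)) R))))) ≫
      Proj.awayι (homogeneousSubmodule (Fin (n + 1)) R) (X d) (isHomogeneous_X R d) one_pos)) :
    letI := MvPolynomial.gradedAlgebra (σ := Fin (n + 1)) (R := R)
    stalkIdeal (Spec.map (CommRingCat.ofHom ((Localization.awayLift (MvPolynomial.eval a) (X d : MvPolynomial (Fin (n + 1)) R) (isUnit_eval_X a d ha)).comp
        (algebraMap (HomogeneousLocalization.Away (homogeneousSubmodule (Fin (n + 1)) R) (X d : MvPolynomial (Fin (n + 1)) R))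
          (Localization.Away (X d : MvPolynomial (Fin (n + 1)) R))))) ≫
      Proj.awayι (homogeneousSubmodule (Fin (n + 1)) R) (X d) (isHomogeneous_X R d) one_pos).ker
      ((Spec.map (CommRingCat.ofHom ((Localization.awayLift (MvPolynomial.eval a) (X d : MvPolynomial (Fin (n + 1)) R) (isUnit_eval_X a d ha)).comp
        (algebraMap (HomogeneousLocalization.Away (homogeneousSubmodule (Fin (n + 1)) R) (X d : MvPolynomial (Fin (n + 1)) R))
          (Localization.Away (X d : MvPolynomial (Fin (n + 1)) R))))) ≫
      Proj.awayι (homogeneousSubmodule (Fin (n + 1)) R) (X d) (isHomogeneous_X R d) one_pos) (IsLocalRing.closedPoint R)) =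
    stalkIdeal (projIdealSheaf (homogeneousSubmodule (Fin (n + 1)) R)
        ⟨Ideal.span (Set.range fun j : Fin (n + 1) => (X j - C (a j) * X d : MvPolynomial (Fin (n + 1)) R)),
          isHomogeneous_span_of_forall_mem _ _ (fun _ => 1) (X_sub_C_mul_X_mem_one a d)⟩)
      ((Spec.map (CommRingCat.ofHom ((Localization.awayLift (MvPolynomial.eval a) (X d : MvPolynomial (Fin (n + 1)) R) (isUnit_eval_X a d ha)).comp
        (algebraMap (HomogeneousLocalization.Away (homogeneousSubmodule (Fin (n + 1)) R) (X d : MvPolynomial (Fin (n + 1)) R))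
          (Localization.Away (X d : MvPolynomial (Fin (n + 1)) R))))) ≫
      Proj.awayι (homogeneousSubmodule (Fin (n + 1)) R) (X d) (isHomogeneous_X R d) one_pos) (IsLocalRing.closedPoint R)) :=
  letI := MvPolynomial.gradedAlgebra (σ := Fin (n + 1)) (R := R)
  le_antisymm (stalkIdeal_ker_sectionOfVec_le a d ha hci)
    (stalkIdeal_mono (projIdealSheaf_le_ker_sectionOfVec a d ha _ (fun _ => 1) (X_sub_C_mul_X_mem_one a d)
      (eval_X_sub_C_mul_X a d ha)) _)

end Summit.ResolutionOfSingularities.ResolutionOfSingularities.Cruxes.EquisingularLiftNat.Sections.Equinodal.SectionOfVec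

end
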